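import Literature.Computability.AlgebraicComplexity.BorderApolarityCandidates
import Literature.Computability.AlgebraicComplexity.LoweringUnipotentMaps
import HarnessLib

/-!
# Symmetry moves on `(110)`-candidates: Kronecker actions, equivariance of the tests, lowering

Topic `Literature/Computability/AlgebraicComplexity`. Companion of `BorderApolarityCandidates.lean`
(the span-side `(110)`-candidate `E ⊆ A ⊗ B` of an approximate decomposition, its `(210)`/`(120)`
test spaces `testI`, `testK`) and `LoweringUnipotentMaps.lean`, for the Borel-fixed normal form of
Conner–Harper–Landsberg 2023, §2.4 (`BorderApolarityBorelFixed.lean`): the symmetry group of the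
tensor acts on candidates, and the conditions defining a candidate are invariant. In coordinates a
pair `(P, Q)` of matrices acts on `K^{ι × κ}` by the Kronecker matrix `P ⊗ₖ Q` (`Matrix.mulVecLin`),
on the `(210)` arrays `K^{ι × ι × κ}` by `P ⊗ₖ (P ⊗ₖ Q)` and on the `(120)` arrays by
`P ⊗ₖ (Q ⊗ₖ Q)`. PROVED here:

* `BorderApolarity.map_testI_le`, `map_testK_le` — `(P ⊗ P ⊗ Q)(testI E) ≤ testI ((P ⊗ Q) E)`
  and the `(120)` analogue (any `P, Q`); with left inverses the moves are injective, so
  `dim testI E ≤ dim testI ((P ⊗ Q)E)` (`finrank_testI_le_map`, `finrank_testK_le_map`) and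
  `dim (P ⊗ Q)E = dim E` (`finrank_map_kronecker_eq`).
* `BorderApolarity.slice_mem_map_of_invariant` — if `t` is invariant under `(P, Q, R)`
  (`∑ P_{aa'} Q_{bb'} R_{cc'} t_{a'b'c'} = t_{abc}`) and `E` contains the slices `t(·,·,c)`, so does
  `(P ⊗ Q)E` (`t(·,·,c) = ∑_{c'} R_{cc'} (P ⊗ Q) t(·,·,c')`).
* `BorderApolarity.isLowering_kronecker` — for `P`, `Q` unitriangular and LOWERING for integer
  weights `eA`, `eB` (`P_{aa'} ≠ 0, a ≠ a' ⇒ eA a < eA a'`), `P ⊗ₖ Q` is a lowering unipotent map for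
  the weight `deg (a,b) = eA a + eB b` (`WtInit.IsLowering (degIK eA eB)`): the root elements of a
  Borel subgroup qualify for the potential argument of `BorderApolarityBorelFixed.lean`.

## References

* A. Conner, A. Harper, J. M. Landsberg, *New lower bounds for matrix multiplication and `det₃`*,
  Forum Math. Pi 11 (2023) e17, arXiv:1911.07981 — §2.4 (`G_T` acts on the variety of limiting
  ideals; normal forms), §3 (the tests). [ConnerHarperLandsberg2023]
-/

noncomputable section

open scoped BigOperators Kronecker
open Matrix

namespace Literature.Computability.AlgebraicComplexity

namespace BorderApolarity

open TensorApolarity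

universe u

variable {K : Type u} [Field K]
variable {ι κ μ : Type} [Fintype ι] [Fintype κ] [DecidableEq ι] [DecidableEq κ]

/-! ## Kronecker moves -/

omit [DecidableEq ι] [DecidableEq κ] in
/-- Entries of `(P ⊗ₖ Q) v` on a pair space. [folklore] -/
theorem kronecker_mulVec_apply (P : Matrix ι ι K) (Q : Matrix κ κ K) (v : ι × κ → K) (p : ι × κ) :
    ((P ⊗ₖ Q) *ᵥ v) p = ∑ a', ∑ b', P p.1 a' * Q p.2 b' * v (a', b') := by
  simp only [mulVec, dotProduct, Fintype.sum_prod_type, kroneckerMap_apply]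

/-- A matrix with a left inverse acts injectively. [folklore] -/
theorem mulVecLin_injective_of_mul_eq_one {m : Type} [Fintype m] [DecidableEq m]
    {M M' : Matrix m m K} (h : M' * M = 1) : Function.Injective M.mulVecLin := by
  intro v w hvw
  have : M' *ᵥ (M *ᵥ v) = M' *ᵥ (M *ᵥ w) := by
    simp only [mulVecLin_apply] at hvw
    rw [hvw]
  rwa [mulVec_mulVec, mulVec_mulVec, h, one_mulVec, one_mulVec] at this

/-- Left inverses of Kronecker products. [folklore] -/
theorem kronecker_mul_kronecker_eq_one {P P' : Matrix ι ι K} {Q Q' : Matrix κ κ K}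
    (hP : P' * P = 1) (hQ : Q' * Q = 1) : (P' ⊗ₖ Q') * (P ⊗ₖ Q) = 1 := by
  rw [← mul_kronecker_mul, hP, hQ, one_kronecker_one]

/-- `dim (P ⊗ Q) E = dim E` for `P, Q` with left inverses. [folklore] -/
theorem finrank_map_kronecker_eq {P P' : Matrix ι ι K} {Q Q' : Matrix κ κ K}
    (hP : P' * P = 1) (hQ : Q' * Q = 1) (E : Submodule K (ι × κ → K)) :
    Module.finrank K (E.map (P ⊗ₖ Q).mulVecLin) = Module.finrank K E :=
  LinearEquiv.finrank_eq (Submodule.equivMapOfInjective _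
    (mulVecLin_injective_of_mul_eq_one (kronecker_mul_kronecker_eq_one hP hQ)) E).symm

/-! ## The tests are equivariant -/

omit [DecidableEq ι] [DecidableEq κ] in
/-- The `ι`-slices of `(P ⊗ P ⊗ Q) y` are `P`-combinations of the moved slices of `y`. [folklore] -/
theorem sliceI_kronecker_mulVec (P : Matrix ι ι K) (Q : Matrix κ κ K) (y : ι × ι × κ → K) (a₀ : ι) :
    sliceI a₀ ((P ⊗ₖ (P ⊗ₖ Q)) *ᵥ y) = ∑ a₀', P a₀ a₀' • ((P ⊗ₖ Q) *ᵥ sliceI a₀' y) := by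
  funext ab
  rw [Finset.sum_apply]
  simp only [sliceI_apply, mulVec, dotProduct, Fintype.sum_prod_type, kroneckerMap_apply,
    Pi.smul_apply, smul_eq_mul, Finset.mul_sum]
  exact Finset.sum_congr rfl fun a _ => Finset.sum_congr rfl fun a' _ =>
    Finset.sum_congr rfl fun b _ => by ring

omit [DecidableEq ι] [DecidableEq κ] in
/-- The `κ`-slices of `(P ⊗ Q ⊗ Q) z` are `Q`-combinations of the moved slices of `z`. [folklore] -/
theorem sliceK_kronecker_mulVec (P : Matrix ι ι K) (Q : Matrix κ κ K) (z : ι × κ × κ → K) (b₁ : κ) :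
    sliceK b₁ ((P ⊗ₖ (Q ⊗ₖ Q)) *ᵥ z) = ∑ b₁', Q b₁ b₁' • ((P ⊗ₖ Q) *ᵥ sliceK b₁' z) := by
  funext ab
  rw [Finset.sum_apply]
  simp only [sliceK_apply, mulVec, dotProduct, Fintype.sum_prod_type, kroneckerMap_apply,
    Pi.smul_apply, smul_eq_mul, Finset.mul_sum]
  symm
  rw [Finset.sum_comm]
  refine Finset.sum_congr rfl fun a' _ => ?_
  rw [Finset.sum_comm]
  exact Finset.sum_congr rfl fun b' _ => Finset.sum_congr rfl fun b₁' _ => by ring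

omit [DecidableEq ι] [DecidableEq κ] in
/-- **`(P ⊗ P ⊗ Q)(testI E) ≤ testI ((P ⊗ Q)E)`**: symmetric arrays stay symmetric and slices in
`E` go to combinations of slices in `(P ⊗ Q)E`. [cite: ConnerHarperLandsberg2023, §2.4] -/
theorem map_testI_le (P : Matrix ι ι K) (Q : Matrix κ κ K) (E : Submodule K (ι × κ → K)) :
    (testI E).map (P ⊗ₖ (P ⊗ₖ Q)).mulVecLin ≤ testI (E.map (P ⊗ₖ Q).mulVecLin) := by
  rintro _ ⟨y, ⟨hys, hyE⟩, rfl⟩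
  refine ⟨fun a₀ a b => ?_, mem_slicesI.2 fun a₀ => ?_⟩
  · simp only [mulVecLin_apply, mulVec, dotProduct, Fintype.sum_prod_type, kroneckerMap_apply]
    rw [Finset.sum_comm]
    refine Finset.sum_congr rfl fun x _ => Finset.sum_congr rfl fun x' _ =>
      Finset.sum_congr rfl fun b' _ => ?_
    rw [(mem_symA K).1 hys x' x b']
    ring
  · rw [mulVecLin_apply, sliceI_kronecker_mulVec]
    refine Submodule.sum_mem _ fun a₀' _ => Submodule.smul_mem _ _ ?_
    exact ⟨sliceI a₀' y, mem_slicesI.1 hyE a₀', rfl⟩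

omit [DecidableEq ι] [DecidableEq κ] in
/-- **`(P ⊗ Q ⊗ Q)(testK E) ≤ testK ((P ⊗ Q)E)`.** [cite: ConnerHarperLandsberg2023, §2.4] -/
theorem map_testK_le (P : Matrix ι ι K) (Q : Matrix κ κ K) (E : Submodule K (ι × κ → K)) :
    (testK E).map (P ⊗ₖ (Q ⊗ₖ Q)).mulVecLin ≤ testK (E.map (P ⊗ₖ Q).mulVecLin) := by
  rintro _ ⟨z, ⟨hzs, hzE⟩, rfl⟩
  refine ⟨fun a b b₁ => ?_, mem_slicesK.2 fun b₁ => ?_⟩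
  · simp only [mulVecLin_apply, mulVec, dotProduct, Fintype.sum_prod_type, kroneckerMap_apply]
    refine Finset.sum_congr rfl fun a' _ => ?_
    rw [Finset.sum_comm]
    refine Finset.sum_congr rfl fun x _ => Finset.sum_congr rfl fun x' _ => ?_
    rw [(mem_symB K).1 hzs a' x' x]
    ring
  · rw [mulVecLin_apply, sliceK_kronecker_mulVec]
    refine Submodule.sum_mem _ fun b₁' _ => Submodule.smul_mem _ _ ?_
    exact ⟨sliceK b₁' z, mem_slicesK.1 hzE b₁', rfl⟩

/-- **The `(210)`-test dimension does not drop under an invertible move.**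
[cite: ConnerHarperLandsberg2023, §2.4] -/
theorem finrank_testI_le_map {P P' : Matrix ι ι K} {Q Q' : Matrix κ κ K} (hP : P' * P = 1)
    (hQ : Q' * Q = 1) (E : Submodule K (ι × κ → K)) :
    Module.finrank K (testI E) ≤ Module.finrank K (testI (E.map (P ⊗ₖ Q).mulVecLin)) := by
  have hinj : Function.Injective (P ⊗ₖ (P ⊗ₖ Q)).mulVecLin :=
    mulVecLin_injective_of_mul_eq_one
      (kronecker_mul_kronecker_eq_one hP (kronecker_mul_kronecker_eq_one hP hQ))
  calc Module.finrank K (testI E)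
      = Module.finrank K ((testI E).map (P ⊗ₖ (P ⊗ₖ Q)).mulVecLin) :=
        (LinearEquiv.finrank_eq (Submodule.equivMapOfInjective _ hinj _)).symm.symm
    _ ≤ _ := Submodule.finrank_mono (map_testI_le P Q E)

/-- **The `(120)`-test dimension does not drop under an invertible move.**
[cite: ConnerHarperLandsberg2023, §2.4] -/
theorem finrank_testK_le_map {P P' : Matrix ι ι K} {Q Q' : Matrix κ κ K} (hP : P' * P = 1)
    (hQ : Q' * Q = 1) (E : Submodule K (ι × κ → K)) :
    Module.finrank K (testK E) ≤ Module.finrank K (testK (E.map (P ⊗ₖ Q).mulVecLin)) := by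
  have hinj : Function.Injective (P ⊗ₖ (Q ⊗ₖ Q)).mulVecLin :=
    mulVecLin_injective_of_mul_eq_one
      (kronecker_mul_kronecker_eq_one hP (kronecker_mul_kronecker_eq_one hQ hQ))
  calc Module.finrank K (testK E)
      = Module.finrank K ((testK E).map (P ⊗ₖ (Q ⊗ₖ Q)).mulVecLin) :=
        (LinearEquiv.finrank_eq (Submodule.equivMapOfInjective _ hinj _)).symm.symm
    _ ≤ _ := Submodule.finrank_mono (map_testK_le P Q E)

/-! ## Slices of an invariant tensor -/

omit [DecidableEq ι] [DecidableEq κ] in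
/-- **Invariance keeps the slices inside the moved candidate.** If
`∑_{a',b',c'} P_{aa'} Q_{bb'} R_{cc'} t_{a'b'c'} = t_{abc}` and `E` contains every slice `t(·,·,c)`,
then so does `(P ⊗ Q)E`: `t(·,·,c) = ∑_{c'} R_{cc'} · (P ⊗ Q) t(·,·,c')`.
[cite: ConnerHarperLandsberg2023, §2.4] -/
theorem slice_mem_map_of_invariant [Fintype μ] (P : Matrix ι ι K) (Q : Matrix κ κ K)
    (R : Matrix μ μ K) (t : ι → κ → μ → K)
    (hinv : ∀ a b c, ∑ a', ∑ b', ∑ c', P a a' * Q b b' * R c c' * t a' b' c' = t a b c)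
    {E : Submodule K (ι × κ → K)} (hE : ∀ c, (fun ab : ι × κ => t ab.1 ab.2 c) ∈ E) (c : μ) :
    (fun ab : ι × κ => t ab.1 ab.2 c) ∈ E.map (P ⊗ₖ Q).mulVecLin := by
  have key : (fun ab : ι × κ => t ab.1 ab.2 c) =
      ∑ c', R c c' • ((P ⊗ₖ Q) *ᵥ fun ab : ι × κ => t ab.1 ab.2 c') := by
    funext ab
    simp only [Finset.sum_apply, Pi.smul_apply, smul_eq_mul, kronecker_mulVec_apply]
    rw [← hinv ab.1 ab.2 c]
    calc ∑ a', ∑ b', ∑ c', P ab.1 a' * Q ab.2 b' * R c c' * t a' b' c'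
        = ∑ a', ∑ c', ∑ b', P ab.1 a' * Q ab.2 b' * R c c' * t a' b' c' :=
          Finset.sum_congr rfl fun a' _ => Finset.sum_comm
      _ = ∑ c', ∑ a', ∑ b', P ab.1 a' * Q ab.2 b' * R c c' * t a' b' c' := Finset.sum_comm
      _ = ∑ c', R c c' * ∑ a', ∑ b', P ab.1 a' * Q ab.2 b' * t a' b' c' := by
          refine Finset.sum_congr rfl fun c' _ => ?_
          rw [Finset.mul_sum]
          refine Finset.sum_congr rfl fun a' _ => ?_
          rw [Finset.mul_sum]
          exact Finset.sum_congr rfl fun b' _ => by ring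
  rw [key]
  exact Submodule.sum_mem _ fun c' _ => Submodule.smul_mem _ _ ⟨_, hE c', rfl⟩

/-! ## Unitriangular lowering factors give lowering unipotent moves -/

/-- A UNITRIANGULAR matrix LOWERING the integer weight `e`: ones on the diagonal, and an
off-diagonal entry `P_{aa'} ≠ 0` only towards strictly smaller weight `e a < e a'` (the unipotent
root elements `1 + s X_α`, `α` negative on the torus). [cite: ConnerHarperLandsberg2023, §2.5] -/
def IsLoweringUnitriangular (e : ι → ℕ) (P : Matrix ι ι K) : Prop :=
  (∀ a, P a a = 1) ∧ ∀ a a', a ≠ a' → P a a' ≠ 0 → e a < e a'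

omit [Fintype ι] [DecidableEq ι] in
/-- Off the diagonal a lowering unitriangular matrix vanishes unless the weight drops. [folklore] -/
theorem IsLoweringUnitriangular.apply_eq_zero {e : ι → ℕ} {P : Matrix ι ι K}
    (hP : IsLoweringUnitriangular e P) {a a' : ι} (hne : a ≠ a') (hle : e a' ≤ e a) : P a a' = 0 := by
  by_contra h
  exact absurd (hP.2 a a' hne h) (not_lt.2 hle)

omit [DecidableEq ι] [DecidableEq κ] in
/-- **`P ⊗ₖ Q` is a lowering unipotent map** for the weight `deg (a, b) = eA a + eB b` when `P`
and `Q` are lowering unitriangular for `eA` and `eB`. [cite: ConnerHarperLandsberg2023, §2.5] -/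
theorem isLowering_kronecker {eA : ι → ℕ} {eB : κ → ℕ} {P : Matrix ι ι K} {Q : Matrix κ κ K}
    (hP : IsLoweringUnitriangular eA P) (hQ : IsLoweringUnitriangular eB Q) :
    WtInit.IsLowering (degIK eA eB) (P ⊗ₖ Q).mulVecLin := by
  intro d φ hφ p hp
  rw [Pi.sub_apply, mulVecLin_apply, mulVec, dotProduct, Finset.sum_eq_single p]
  · simp [kroneckerMap_apply, hP.1, hQ.1]
  · -- a term at `q ≠ p` vanishes: otherwise `deg p < deg q = d ≤ deg p`
    intro q _ hq
    rw [kroneckerMap_apply]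
    by_cases hφ0 : φ q = 0
    · rw [hφ0, mul_zero]
    by_cases hPa : P p.1 q.1 = 0
    · rw [hPa, zero_mul, zero_mul]
    by_cases hQb : Q p.2 q.2 = 0
    · rw [hQb, mul_zero, zero_mul]
    exfalso
    have hdeg := hφ q hφ0
    have hA : eA p.1 ≤ eA q.1 ∧ (p.1 ≠ q.1 → eA p.1 < eA q.1) := by
      rcases eq_or_ne p.1 q.1 with h | h
      · exact ⟨by rw [h], fun h' => absurd h h'⟩
      · exact ⟨(hP.2 _ _ h hPa).le, fun _ => hP.2 _ _ h hPa⟩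
    have hB : eB p.2 ≤ eB q.2 ∧ (p.2 ≠ q.2 → eB p.2 < eB q.2) := by
      rcases eq_or_ne p.2 q.2 with h | h
      · exact ⟨by rw [h], fun h' => absurd h h'⟩
      · exact ⟨(hQ.2 _ _ h hQb).le, fun _ => hQ.2 _ _ h hQb⟩
    have hlt : eA p.1 + eB p.2 < eA q.1 + eB q.2 := by
      rcases ne_or_eq p.1 q.1 with h | h
      · have := hA.2 h; omega
      · have h2 : p.2 ≠ q.2 := fun h2 => hq (Prod.ext h h2).symm
        have := hB.2 h2; omega
    simp only [degIK, wt₁] at hp hdeg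
    push_cast at hp hdeg
    omega
  · intro h; exact absurd (Finset.mem_univ _) h

end BorderApolarity

end Literature.Computability.AlgebraicComplexity

end
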